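import Literature.Probability.Distributions.BrascampLiebMarginal
import Literature.Probability.Distributions.BrascampLiebMatrix
import HarnessLib

/-!
# Fibers in the Brascamp–Lieb induction: tameness transfer and the pointwise bounds

`Literature/Probability/Distributions/`. For the induction step `ℝⁿ → ℝⁿ⁺¹` of Brascamp–Lieb 1976,
Theorem 4.1 (pp. 377–378) we restrict a tame potential `f` and a tame observable to the fibers
`z ↦ (y, z)`:

* the fiber potential `z ↦ f(y, z)` is again tame (`C²`, positive definite Hessian, linear
  coercivity, polynomial derivative bounds with constant `K(1+|y|)ᵏ`), and so are the fiber
  observables `h(y, ·) + t ∂_y f(y, ·)`;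
* the pointwise inequality feeding the "arbitrary `λ, μ`" argument of p. 378: for `x = (y, z)`,
  `⟨∇_z(h + t f_y), f_zz⁻¹ ∇_z(h + t f_y)⟩ ≤ ⟨h_x, f_xx⁻¹ h_x⟩ + 2t h_y + t² f_yy`
  (`fiber_quadForm_bound`), and the strict Schur bound `⟨f_zy, f_zz⁻¹ f_zy⟩ < f_yy`
  (`fiber_quadForm_fy_lt`);
* continuity (hence measurability) of `x ↦ ⟨h_x, f_xx⁻¹ h_x⟩`.

Theorems only. References: H. J. Brascamp, E. H. Lieb, J. Funct. Anal. 22 (1976) 366–389,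
pp. 377–378. [BrascampLieb1976]
-/

noncomputable section

open MeasureTheory Filter Set Matrix
open Literature.Analysis.OperatorTheory (consZeroL consZeroL_apply cons_zero_single norm_le_norm_cons)
open scoped ENNReal Topology

namespace Literature.Probability.Distributions

namespace BrascampLiebFiber

open BrascampLiebCalculus BrascampLiebDensity BrascampLiebMarginal BrascampLiebMatrix

variable {n : ℕ}

/-! ### Tameness of fibers -/

section Tame

variable {f : (Fin (n + 1) → ℝ) → ℝ} {K c C₀ : ℝ} {k : ℕ}

/-- The fiber potential has positive definite Hessian. [folklore] -/
theorem posDef_coordHessian_fiber (hf : ContDiff ℝ 2 f) (hpd : ∀ x, (coordHessian f x).PosDef)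
    (y : ℝ) (z : Fin n → ℝ) : (coordHessian (fun w => f (Fin.cons y w)) z).PosDef := by
  rw [coordHessian_fiber hf]
  exact posDef_submatrix_succ (hpd _)

/-- Linear coercivity passes to fibers (sup norm: `‖z‖ ≤ ‖(y, z)‖`). [folklore] -/
theorem coercive_fiber (hc : 0 < c) (hcoer : ∀ x, c * ‖x‖ - C₀ ≤ f x) (y : ℝ) (z : Fin n → ℝ) :
    c * ‖z‖ - C₀ ≤ f (Fin.cons y z) := by
  have h1 := hcoer (Fin.cons y z)
  have h2 := norm_le_norm_cons y z
  nlinarith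

/-- Values on a fiber: `|φ(y, z)| ≤ K'(1+|y|)^{k'} (1+‖z‖)^{k'}`. [folklore] -/
theorem value_fiber_bound {φ : (Fin (n + 1) → ℝ) → ℝ} {K' : ℝ} {k' : ℕ} (hK' : 0 ≤ K')
    (hb : ∀ x, |φ x| ≤ K' * (1 + ‖x‖) ^ k') (y : ℝ) (z : Fin n → ℝ) :
    |φ (Fin.cons y z)| ≤ K' * (1 + |y|) ^ k' * (1 + ‖z‖) ^ k' := by
  refine (hb _).trans ?_
  rw [mul_assoc]
  exact mul_le_mul_of_nonneg_left (one_add_norm_cons_pow_le y z k') hK'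

/-- First derivatives on a fiber: `|D(φ(y,·))(z) v| ≤ K'(1+|y|)^{k'}(1+‖z‖)^{k'}‖v‖`. [folklore] -/
theorem fderiv_fiber_bound {φ : (Fin (n + 1) → ℝ) → ℝ} (hφ : Differentiable ℝ φ) {K' : ℝ} {k' : ℕ}
    (hK' : 0 ≤ K') (hb : ∀ x v, |fderiv ℝ φ x v| ≤ K' * (1 + ‖x‖) ^ k' * ‖v‖) (y : ℝ)
    (z v : Fin n → ℝ) :
    |fderiv ℝ (fun w => φ (Fin.cons y w)) z v| ≤ K' * (1 + |y|) ^ k' * (1 + ‖z‖) ^ k' * ‖v‖ := by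
  rw [fderiv_fiber_apply hφ]
  refine (hb _ _).trans ?_
  rw [norm_cons_zero]
  have := one_add_norm_cons_pow_le y z k'
  have hv := norm_nonneg v
  calc K' * (1 + ‖(Fin.cons y z : Fin (n + 1) → ℝ)‖) ^ k' * ‖v‖
      ≤ K' * ((1 + |y|) ^ k' * (1 + ‖z‖) ^ k') * ‖v‖ := by gcongr
    _ = K' * (1 + |y|) ^ k' * (1 + ‖z‖) ^ k' * ‖v‖ := by ring

/-- Second derivatives on a fiber. [folklore] -/
theorem fderiv2_fiber_bound (hf : ContDiff ℝ 2 f) (hK : 0 ≤ K)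
    (hbd2 : ∀ x v w, |fderiv ℝ (fun x' => fderiv ℝ f x' v) x w| ≤ K * (1 + ‖x‖) ^ k * ‖v‖ * ‖w‖)
    (y : ℝ) (z v w : Fin n → ℝ) :
    |fderiv ℝ (fun z' => fderiv ℝ (fun w' => f (Fin.cons y w')) z' v) z w| ≤
      K * (1 + |y|) ^ k * (1 + ‖z‖) ^ k * ‖v‖ * ‖w‖ := by
  have hd : Differentiable ℝ f := hf.differentiable two_ne_zero
  have e : (fun z' => fderiv ℝ (fun w' => f (Fin.cons y w')) z' v) =
      fun z' => (fun x => fderiv ℝ f x (Fin.cons 0 v)) (Fin.cons y z') := by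
    funext z'
    exact fderiv_fiber_apply hd y z' v
  rw [e]
  have hd1 : Differentiable ℝ (fun x => fderiv ℝ f x (Fin.cons 0 v)) := fun x =>
    (hasFDerivAt_fderiv_apply hf x _).differentiableAt
  rw [fderiv_fiber_apply hd1]
  refine (hbd2 _ _ _).trans ?_
  rw [norm_cons_zero, norm_cons_zero]
  have := one_add_norm_cons_pow_le y z k
  have hv := norm_nonneg v
  have hw := norm_nonneg w
  calc K * (1 + ‖(Fin.cons y z : Fin (n + 1) → ℝ)‖) ^ k * ‖v‖ * ‖w‖
      ≤ K * ((1 + |y|) ^ k * (1 + ‖z‖) ^ k) * ‖v‖ * ‖w‖ := by gcongr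
    _ = K * (1 + |y|) ^ k * (1 + ‖z‖) ^ k * ‖v‖ * ‖w‖ := by ring

/-- **The fiber potential is tame** with constant `K(1+|y|)ᵏ`: `C²`, positive definite Hessian,
linearly coercive, first and second derivatives polynomially bounded.
[cite: BrascampLieb1976, Thm 4.1 (proof, p. 377, induction hypothesis)] -/
theorem tame_fiber (hf : ContDiff ℝ 2 f) (hpd : ∀ x, (coordHessian f x).PosDef) (hK : 0 ≤ K)
    (hc : 0 < c) (hcoer : ∀ x, c * ‖x‖ - C₀ ≤ f x)
    (hbd1 : ∀ x v, |fderiv ℝ f x v| ≤ K * (1 + ‖x‖) ^ k * ‖v‖)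
    (hbd2 : ∀ x v w, |fderiv ℝ (fun x' => fderiv ℝ f x' v) x w| ≤ K * (1 + ‖x‖) ^ k * ‖v‖ * ‖w‖)
    (y : ℝ) :
    ContDiff ℝ 2 (fun w : Fin n → ℝ => f (Fin.cons y w)) ∧
    (∀ z, (coordHessian (fun w => f (Fin.cons y w)) z).PosDef) ∧
    (∀ z : Fin n → ℝ, c * ‖z‖ - C₀ ≤ f (Fin.cons y z)) ∧
    (∀ z v, |fderiv ℝ (fun w => f (Fin.cons y w)) z v| ≤ K * (1 + |y|) ^ k * (1 + ‖z‖) ^ k * ‖v‖) ∧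
    (∀ z v w, |fderiv ℝ (fun z' => fderiv ℝ (fun w' => f (Fin.cons y w')) z' v) z w| ≤
      K * (1 + |y|) ^ k * (1 + ‖z‖) ^ k * ‖v‖ * ‖w‖) :=
  ⟨contDiff_fiber hf y, posDef_coordHessian_fiber hf hpd y, coercive_fiber hc hcoer y,
    fderiv_fiber_bound (hf.differentiable two_ne_zero) hK hbd1 y, fderiv2_fiber_bound hf hK hbd2 y⟩

/-- **The fiber observables `h(y,·) + t ∂_y f(y,·)` are tame** with constant
`(1+|t|) K (1+|y|)ᵏ`. [cite: BrascampLieb1976, Thm 4.1 (proof, p. 378, "H = λ h + μ f_y")] -/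
theorem tame_fiber_obs (hf : ContDiff ℝ 2 f) (hK : 0 ≤ K)
    (hbd1 : ∀ x v, |fderiv ℝ f x v| ≤ K * (1 + ‖x‖) ^ k * ‖v‖)
    (hbd2 : ∀ x v w, |fderiv ℝ (fun x' => fderiv ℝ f x' v) x w| ≤ K * (1 + ‖x‖) ^ k * ‖v‖ * ‖w‖)
    {h : (Fin (n + 1) → ℝ) → ℝ} (hh : ContDiff ℝ 1 h) (hhb : ∀ x, |h x| ≤ K * (1 + ‖x‖) ^ k)
    (hhb1 : ∀ x v, |fderiv ℝ h x v| ≤ K * (1 + ‖x‖) ^ k * ‖v‖) (y t : ℝ) :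
    ContDiff ℝ 1 (fun w : Fin n → ℝ =>
      h (Fin.cons y w) + t * fderiv ℝ f (Fin.cons y w) (Pi.single 0 1)) ∧
    (∀ z : Fin n → ℝ, |h (Fin.cons y z) + t * fderiv ℝ f (Fin.cons y z) (Pi.single 0 1)| ≤
      (1 + |t|) * K * (1 + |y|) ^ k * (1 + ‖z‖) ^ k) ∧
    (∀ z v : Fin n → ℝ, |fderiv ℝ (fun w : Fin n → ℝ =>
        h (Fin.cons y w) + t * fderiv ℝ f (Fin.cons y w) (Pi.single 0 1)) z v| ≤
      (1 + |t|) * K * (1 + |y|) ^ k * (1 + ‖z‖) ^ k * ‖v‖) := by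
  obtain ⟨hfy1, hfyb, hfyb1⟩ := fy_bounds hf hbd1 hbd2
  -- the observable `x ↦ h x + t f_y x` on `ℝⁿ⁺¹`
  set ψ : (Fin (n + 1) → ℝ) → ℝ := fun x => h x + t * fderiv ℝ f x (Pi.single 0 1) with hψ
  have hψ1 : ContDiff ℝ 1 ψ := hh.add (contDiff_const.mul hfy1)
  have hψb : ∀ x, |ψ x| ≤ (1 + |t|) * K * (1 + ‖x‖) ^ k := fun x => by
    have e1 := hhb x
    have e2 := hfyb x
    calc |ψ x| ≤ |h x| + |t * fderiv ℝ f x (Pi.single 0 1)| := abs_add_le _ _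
      _ = |h x| + |t| * |fderiv ℝ f x (Pi.single 0 1)| := by rw [abs_mul]
      _ ≤ K * (1 + ‖x‖) ^ k + |t| * (K * (1 + ‖x‖) ^ k) := by gcongr
      _ = (1 + |t|) * K * (1 + ‖x‖) ^ k := by ring
  have hψb1 : ∀ x v, |fderiv ℝ ψ x v| ≤ (1 + |t|) * K * (1 + ‖x‖) ^ k * ‖v‖ := fun x v => by
    have hd1 : DifferentiableAt ℝ h x := (hh.differentiable one_ne_zero) x
    have hd2 : DifferentiableAt ℝ (fun x => fderiv ℝ f x (Pi.single 0 1)) x :=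
      (hfy1.differentiable one_ne_zero) x
    have e : fderiv ℝ ψ x = fderiv ℝ h x + t • fderiv ℝ (fun x => fderiv ℝ f x (Pi.single 0 1)) x :=
      (hd1.hasFDerivAt.add (hd2.hasFDerivAt.const_mul t)).fderiv
    rw [e, show (fderiv ℝ h x + t • fderiv ℝ (fun x => fderiv ℝ f x (Pi.single 0 1)) x) v =
      fderiv ℝ h x v + t * fderiv ℝ (fun x => fderiv ℝ f x (Pi.single 0 1)) x v from rfl]
    have e1 := hhb1 x v
    have e2 := hfyb1 x v
    calc |fderiv ℝ h x v + t * fderiv ℝ (fun x => fderiv ℝ f x (Pi.single 0 1)) x v|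
        ≤ |fderiv ℝ h x v| + |t * fderiv ℝ (fun x => fderiv ℝ f x (Pi.single 0 1)) x v| := abs_add_le _ _
      _ = |fderiv ℝ h x v| + |t| * |fderiv ℝ (fun x => fderiv ℝ f x (Pi.single 0 1)) x v| := by
          rw [abs_mul]
      _ ≤ K * (1 + ‖x‖) ^ k * ‖v‖ + |t| * (K * (1 + ‖x‖) ^ k * ‖v‖) := by gcongr
      _ = (1 + |t|) * K * (1 + ‖x‖) ^ k * ‖v‖ := by ring
  have hK' : 0 ≤ (1 + |t|) * K := by positivity
  exact ⟨contDiff_fiber hψ1 y, value_fiber_bound hK' hψb y,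
    fderiv_fiber_bound (hψ1.differentiable one_ne_zero) hK' hψb1 y⟩

end Tame

/-! ### The pointwise quadratic-form bounds on a fiber -/

section Pointwise

variable {f h : (Fin (n + 1) → ℝ) → ℝ}

/-- Gradient of the fiber observable `h(y,·) + t ∂_y f(y,·)`:
`∇_z(h + t f_y)(y,z)ⱼ = (h_x)_{j+1} + t (f_xx)_{j+1,0}`. [folklore] -/
theorem coordGradient_fiber_obs (hf : ContDiff ℝ 2 f) (hh : Differentiable ℝ h) (y t : ℝ)
    (z : Fin n → ℝ) :
    coordGradient (fun w : Fin n → ℝ =>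
        h (Fin.cons y w) + t * fderiv ℝ f (Fin.cons y w) (Pi.single 0 1)) z =
      (fun j => coordGradient h (Fin.cons y z) j.succ) +
        t • fun j => coordHessian f (Fin.cons y z) j.succ 0 := by
  have hfy : Differentiable ℝ fun x => fderiv ℝ f x (Pi.single 0 1) := fun x =>
    (hasFDerivAt_fderiv_apply hf x _).differentiableAt
  have hψ : Differentiable ℝ fun x => h x + t * fderiv ℝ f x (Pi.single 0 1) :=
    hh.add (hfy.const_mul t)
  rw [coordGradient_fiber (h := fun x => h x + t * fderiv ℝ f x (Pi.single 0 1)) hψ]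
  funext j
  simp only [coordGradient, coordHessian, Matrix.of_apply, Pi.add_apply, Pi.smul_apply, smul_eq_mul]
  have e : fderiv ℝ (fun x => h x + t * fderiv ℝ f x (Pi.single 0 1)) (Fin.cons y z) =
      fderiv ℝ h (Fin.cons y z) + t • fderiv ℝ (fun x => fderiv ℝ f x (Pi.single 0 1)) (Fin.cons y z) :=
    ((hh _).hasFDerivAt.add ((hfy _).hasFDerivAt.const_mul t)).fderiv
  rw [e]
  rfl

/-- **The pointwise fiber bound** (the "arbitrary `λ, μ`" step of p. 378 combined with (4.10)):
for `x = (y, z)` and every `t`,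
`⟨∇_z(h + t f_y), f_zz⁻¹ ∇_z(h + t f_y)⟩(x) ≤ ⟨h_x, f_xx⁻¹ h_x⟩(x) + 2t h_y(x) + t² f_yy(x)`.
[cite: BrascampLieb1976, Thm 4.1 (proof, p. 378, (4.9)–(4.10))] -/
theorem fiber_quadForm_bound (hf : ContDiff ℝ 2 f) (hpd : ∀ x, (coordHessian f x).PosDef)
    (hh : Differentiable ℝ h) (y t : ℝ) (z : Fin n → ℝ) :
    coordGradient (fun w : Fin n → ℝ => h (Fin.cons y w) + t * fderiv ℝ f (Fin.cons y w) (Pi.single 0 1)) z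
        ⬝ᵥ ((coordHessian (fun w => f (Fin.cons y w)) z)⁻¹ *ᵥ
          coordGradient (fun w : Fin n → ℝ =>
            h (Fin.cons y w) + t * fderiv ℝ f (Fin.cons y w) (Pi.single 0 1)) z) ≤
      coordGradient h (Fin.cons y z) ⬝ᵥ ((coordHessian f (Fin.cons y z))⁻¹ *ᵥ coordGradient h (Fin.cons y z))
        + 2 * t * coordGradient h (Fin.cons y z) 0 + t ^ 2 * coordHessian f (Fin.cons y z) 0 0 := by
  rw [coordGradient_fiber_obs hf hh, coordHessian_fiber hf]
  have := fiber_quadForm_le (hpd (Fin.cons y z)) (coordGradient h (Fin.cons y z)) t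
  simp only at this
  linarith

/-- Gradient of the fiber observable `∂_y f(y, ·)`: the column `(f_xx)_{·+1, 0}`. [folklore] -/
theorem coordGradient_fiber_fy (hf : ContDiff ℝ 2 f) (y : ℝ) (z : Fin n → ℝ) :
    coordGradient (fun w : Fin n → ℝ => fderiv ℝ f (Fin.cons y w) (Pi.single 0 1)) z =
      fun j => coordHessian f (Fin.cons y z) j.succ 0 := by
  have hfy : Differentiable ℝ fun x => fderiv ℝ f x (Pi.single 0 1) := fun x =>
    (hasFDerivAt_fderiv_apply hf x _).differentiableAt
  rw [coordGradient_fiber (h := fun x => fderiv ℝ f x (Pi.single 0 1)) hfy]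
  rfl

/-- **The strict Schur bound on a fiber**: `⟨∇_z f_y, f_zz⁻¹ ∇_z f_y⟩(x) < f_yy(x)`.
[cite: BrascampLieb1976, Thm 4.2, eq. (4.7)] -/
theorem fiber_quadForm_fy_lt (hf : ContDiff ℝ 2 f) (hpd : ∀ x, (coordHessian f x).PosDef)
    (y : ℝ) (z : Fin n → ℝ) :
    coordGradient (fun w : Fin n → ℝ => fderiv ℝ f (Fin.cons y w) (Pi.single 0 1)) z
        ⬝ᵥ ((coordHessian (fun w => f (Fin.cons y w)) z)⁻¹ *ᵥ
          coordGradient (fun w : Fin n → ℝ => fderiv ℝ f (Fin.cons y w) (Pi.single 0 1)) z) <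
      coordHessian f (Fin.cons y z) 0 0 := by
  rw [coordGradient_fiber_fy hf, coordHessian_fiber hf]
  have := schur_pos (hpd (Fin.cons y z))
  linarith

/-- `⟨∇_z k, f_zz⁻¹ ∇_z k⟩ ≥ 0` on fibers. [folklore] -/
theorem fiber_quadForm_nonneg (hf : ContDiff ℝ 2 f) (hpd : ∀ x, (coordHessian f x).PosDef)
    (y : ℝ) (z : Fin n → ℝ) (γ : Fin n → ℝ) :
    0 ≤ γ ⬝ᵥ ((coordHessian (fun w => f (Fin.cons y w)) z)⁻¹ *ᵥ γ) :=
  dotProduct_inv_mulVec_nonneg (posDef_coordHessian_fiber hf hpd y z) γ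

end Pointwise

/-! ### Continuity of `x ↦ ⟨h_x, f_xx⁻¹ h_x⟩` -/

section Continuity

variable {m : ℕ}

/-- The inverse of a continuous family of positive definite matrices is continuous. [folklore] -/
theorem continuous_inv_of_posDef {X : Type*} [TopologicalSpace X] {M : X → Matrix (Fin m) (Fin m) ℝ}
    (hM : Continuous M) (hpd : ∀ x, (M x).PosDef) : Continuous fun x => (M x)⁻¹ := by
  refine continuous_iff_continuousAt.2 fun x => ?_
  have hdet : (M x).det ≠ 0 :=
    (((M x).isUnit_iff_isUnit_det).1 (hpd x).isUnit).ne_zero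
  have h1 : ContinuousAt Ring.inverse (M x).det := by
    have := NormedRing.inverse_continuousAt (Units.mk0 _ hdet)
    simpa using this
  exact (continuousAt_matrix_inv (M x) h1).comp hM.continuousAt

/-- `x ↦ ⟨h_x, f_xx⁻¹ h_x⟩` is continuous for `f ∈ C²` with `f_xx > 0` and `h ∈ C¹`. [folklore] -/
theorem continuous_quadForm {f h : (Fin m → ℝ) → ℝ} (hf : ContDiff ℝ 2 f)
    (hpd : ∀ x, (coordHessian f x).PosDef) (hh : ContDiff ℝ 1 h) :
    Continuous fun x => coordGradient h x ⬝ᵥ ((coordHessian f x)⁻¹ *ᵥ coordGradient h x) :=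
  (continuous_coordGradient hh).dotProduct
    ((continuous_inv_of_posDef (continuous_coordHessian hf) hpd).matrix_mulVec
      (continuous_coordGradient hh))

/-- `⟨h_x, f_xx⁻¹ h_x⟩ ≥ 0`. [folklore] -/
theorem quadForm_nonneg {f h : (Fin m → ℝ) → ℝ} (hpd : ∀ x, (coordHessian f x).PosDef) (x : Fin m → ℝ) :
    0 ≤ coordGradient h x ⬝ᵥ ((coordHessian f x)⁻¹ *ᵥ coordGradient h x) :=
  dotProduct_inv_mulVec_nonneg (hpd x) _

end Continuity

end BrascampLiebFiber

end Literature.Probability.Distributions
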